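import Literature.Geometry.Lorentzian.KerrIntegratedDecayUniform
import HarnessLib

/-!
# Integrated local energy decay on sub-extremal Kerr WITH THE ZEROTH-ORDER TERM and at every
# order, `a₀`-uniform (Dafermos–Rodnianski–Shlapentokh-Rothman, Thm. 3.1 (24) ∧ Thm. 3.2 (25),
# named fact)

`KerrIntegratedDecayUniform.lean` vendors display (25) of Dafermos–Rodnianski–Shlapentokh-Rothman,
arXiv:1402.7034 = Ann. of Math. 183 (2016), Thm. 3.2, at `j = 2`, `a₀`-uniformly, as the named fact
`DafermosRodnianskiShlapentokhRothman2016_integratedDecay_uniform`: on the left the FIRST-ORDER local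
coordinate energy `∫₀^∞ E_loc(τ, R) dτ` only. The printed theorems say more:

* Thm. 3.1, display **(24)** (p. 13 of the arXiv text):
  `∫_{𝓡₀} (r⁻¹ζ|∇̸ψ|² + r^{-1-δ}ζ(Tψ)² + r^{-1-δ}(Z̃*ψ)² + r^{-3-δ}(ψ − ψ_∞)²) ≤ C ∫_{Σ₀} J^N_μ[ψ] n^μ_{Σ₀}`
  with `4πψ_∞² = lim_{r' → ∞} ∫_{Σ₀ ∩ {r = r'}} r⁻² ψ²` — it carries the **zeroth-order** term
  `r^{-3-δ}(ψ − ψ_∞)²`, and `ψ_∞ = 0` for data compactly supported on `Σ̃₀`;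
* Thm. 3.2, display **(25)**, for EVERY `j ≥ 1`: the second line
  `r^{-1-δ} ∑_{1 ≤ i₁+i₂+i₃ ≤ j−1} (|∇̸^{i₁}T^{i₂}(Z̃*)^{i₃+1}ψ|² + |∇̸^{i₁}T^{i₂}(Z*)^{i₃}ψ|²)` does not
  degenerate at trapping and, `(T, Z*, ∂_θ, ∂_{φ*})` being the regular Kerr-star frame up to `𝓗⁺`,
  dominates every Kerr–Schild coordinate derivative of `ψ` of order `1, …, j − 1` on `{r ≤ R}`;
  the right-hand side is `C ∫_{Σ₀} ∑_{0 ≤ i ≤ j−1} J^N_μ[N^iψ] n^μ_{Σ₀}`.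

Both hold "for all `|a| ≤ a₀`" with `C = C(a₀, M, δ, j)` (§3.1–§3.2), and both generalise to
admissible hypersurfaces `Σ̃₀` with `𝓡₀ = D⁺(Σ̃₀)` and `N` kept (§3.3, p. 14). This file vendors the
CONJUNCTION (24) ∧ (25) at every order, in exactly the vocabulary and the one-sided weakened form of
`KerrIntegratedDecay.lean` / `KerrIntegratedDecayUniform.lean` (Kerr–Schild graphs `{t*_KS = F(y)}`
flat on a ball of radius `ρ ≥ R₀`, the class `IsAdmissibleKerrWaveOn M a F`), as the named fact

* `DafermosRodnianskiShlapentokhRothman2016_integratedDecayZeroth_uniform`: for `0 ≤ a₀ < M` and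
  `j : ℕ` there is `R₀` such that for admissible `F` flat on `{‖y‖ ≤ ρ}`, `ρ ≥ R₀`, `R ≤ ρ`, some
  `C < ∞` serves all `|a| ≤ a₀` and all `ψ` of the class:
  `∫₀^∞ 𝓔_j(τ, R) dτ ≤ C (𝓔_{j+1}[ψ](Σ̃₀ ∩ {‖y‖ ≤ ρ}) + ∑_{i ≤ j} E^far_F[T^iψ](0))`, where
  `𝓔_j(τ, R) = sliceSobolevEnergy … ψ τ j 0 (closedBall 0 R)` is the order-`j` coordinate Sobolev
  energy through `{t*_KS = τ} ∩ {‖y‖ ≤ R}` — ZEROTH ORDER INCLUDED.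

and proves the cheap implications:

* `localSliceEnergy_le_four_mul_sliceSobolevEnergy` — `E_loc(τ, R) ≤ 4 𝓔_{k+1}(τ, R)`;
* `DafermosRodnianskiShlapentokhRothman2016_integratedDecay_uniform_of_zeroth` — the new fact at
  `j = 1` implies the vendored `a₀`-uniform (25) fact (drop the zeroth-order term; constant `4C`);
* `DafermosRodnianskiShlapentokhRothman2016_integratedDecay_of_zeroth` — hence the non-uniform one.

Why: the `κ`-explicit programme near extremality (crux `PhaseMixingCapture.KappaExplicitWaveDecay` of
the summit `FinalStateConjecture`, stub S6a′) runs DRSR §9 for FUTURE-INTEGRABLE waves and needs,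
qualitatively at each fixed spin, the time-integrability of the local coordinate Sobolev energies of
ALL orders, zeroth order included (DRSR Def. 5.1.1 / 9.1.1 "sufficiently integrable"). The vendored
(25) at `j = 2` gives neither the zeroth order (a profile `ψ ≈ (1 + τ)^{-1/2}` on a ball has
time-integrable `|∂ψ|²` but not `|ψ|²`: the zeroth order does not follow abstractly from first-order
integrated decay and boundedness) nor the orders `≥ 2`; both ARE printed, in (24) and in (25) at
order `j + 1`. Nothing is proved here about (24)/(25) themselves (D-0014); discharging this fact
discharges `DafermosRodnianskiShlapentokhRothman2016_integratedDecay_uniform`.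

## The printed estimates and the vendored consequence

Take `Σ̃₀ = {t*_KS = F(y)}` with `F` admissible, `F = 0` on `{‖y‖ ≤ ρ}`, `ρ ≥ R₀(M, a₀)`, `R ≤ ρ`,
and `ψ` smooth on the exterior chart with data compactly supported on the open graph.
* LHS. `{t*_KS > 0, ‖y‖ ≤ R, r > r₊} ⊆ D⁺(Σ̃₀) ∩ {r ≤ R}` (`F = 0` on the ball, `r ≤ ‖y‖`), volume
  `dt*_KS d³y` (`det g = −1`). Zeroth order: `r^{-3-δ}(ψ − ψ_∞)² = r^{-3-δ}ψ² ≥ R^{-3-δ}ψ²` there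
  (`ψ_∞ = 0`: `ψ` vanishes on `Σ̃₀ ∩ {r = r'}` for large `r'`), from (24). Orders `1, …, j`: the second
  line of (25) at order `j + 1` contains `r^{-1-δ}|∇̸^{i₁}T^{i₂}(Z*)^{i₃}ψ|²` for all
  `1 ≤ i₁+i₂+i₃ ≤ j`, with no `ζ`; the Kerr-star coordinates `(t*, r, θ, φ*)` and the ingoing
  Kerr–Schild coordinates `(t*_KS, y)` differ by a diffeomorphism smooth up to and including `𝓗⁺`
  and independent of time up to translation, so on `{r₊ < r ≤ R}` the family dominates
  `c(M, a₀, R, j) ∑_{1 ≤ |α| ≤ j} |∂^α_y,t* ψ̃|²` (chain rule; angular covariant vs. coordinate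
  derivatives and frame commutators differ by lower-order terms, which the family also contains).
  Together: `≥ c · ∑_{m ≤ j} ‖D^m ψ̃‖²`, the integrand of `sliceSobolevEnergy … ψ τ j 0 (closedBall 0 R)`.
* RHS. (24): `C ∫_{Σ̃₀} J^N[ψ]·n`; (25) at order `j + 1`: `C ∫_{Σ̃₀} ∑_{i ≤ j} J^N[N^iψ]·n`. Flat
  part `{t*_KS = 0, ‖y‖ ≤ ρ}`: `N`, `n` smooth up to `𝓗⁺` and `φ_τ`-invariant, so
  `∑_{i ≤ j} J^N[N^iψ]·n ≤ C ∑_{|α| ≤ j+1}|∂^αψ̃|²`, i.e. at most `C · sliceSobolevEnergy … ψ 0 (j+1) 0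
  (closedBall 0 ρ)`. Far part `{‖y‖ > ρ}`: `r ≥ r₁(a₀, M)` there, so `N = T` (Prop. 4.5.1, built for
  the whole range `|a| ≤ a₀`, Def. 4.1 (i) of arXiv:1010.5132), `N^iψ = T^iψ = ∂^i_{t*}ψ̃`
  (`timeDeriv^[i]`), and the `J^T` flux densities through the graph w.r.t. `dy` are
  `≤ C ∑_μ(∂_μ ·)²`: at most `C ∑_{i ≤ j} graphSliceEnergyOn … (timeDeriv^[i] ψ) F 0 {ρ < ‖y‖}`.
Each step weakens; the constants depend on `(M, a₀, j, F, ρ, R)` only, as printed ("`C` depends only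
on `a₀`, `M`", and on `δ := 1`, `j`).

## References

* M. Dafermos, I. Rodnianski, Y. Shlapentokh-Rothman, *Decay for solutions of the wave equation on
  Kerr exterior spacetimes III: the full subextremal case `|a| < M`*, Ann. of Math. 183 (2016)
  787–913, arXiv:1402.7034: §3.1 Thm. 3.1 (24) (p. 13, with the definition of `ψ_∞`), §3.2 Thm. 3.2
  (25), §3.3 (p. 14: admissible `Σ̃₀`; "`0 ≤ a₀ < M` … for all `|a| ≤ a₀`"), §2.1.2 (`Z*`), §2.2.3
  (`ζ`, `Z̃*`), Prop. 4.5.1 (`N = T` for `r ≥ r₁`), Prop. 9.1.1 (the term `r^{-3-δ}|ψ|²`), Def. 5.1.1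
  (key `DafermosRodnianskiShlapentokhrothman2014`).
* M. Dafermos, I. Rodnianski, arXiv:1010.5132, §4.4 Def. 4.1 (i), Prop. 4.5.1, Prop. 4.6.1
  (key `DafermosRodnianski2010KerrSmallA`).
-/

noncomputable section

open Set Filter MeasureTheory Metric TopologicalSpace
open scoped Topology ENNReal Manifold ContDiff

namespace Literature.Geometry.Lorentzian

/-! ### The local first-order energy below the local Sobolev energy -/

/-- **Local first-order energy below the local Sobolev energy**: `E_loc(τ, R) ≤ 4 · 𝓔_{k+1}(τ, R)`
(`localSliceEnergy U ψ τ R ≤ 4 · sliceSobolevEnergy U ψ τ (k + 1) 0 (closedBall 0 R)`; the `m = 1`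
term of the Sobolev integrand dominates `¼ ∑_μ(∂_μψ̃)²`, `coordEnergyDensity_le_four_mul_norm_fderiv_sq`).
[folklore] -/
theorem localSliceEnergy_le_four_mul_sliceSobolevEnergy (U : Opens E4) (ψ : U → ℝ) (τ : ℝ) (k : ℕ)
    (R : ℝ) :
    localSliceEnergy U ψ τ R ≤ 4 * sliceSobolevEnergy U ψ τ (k + 1) 0 (closedBall (0 : E3) R) := by
  unfold localSliceEnergy sliceSobolevEnergy
  rw [← lintegral_const_mul' _ _ (by simp)]
  refine lintegral_mono fun y ↦ ?_
  by_cases hy : E4.ofTimeSpace τ y ∈ U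
  · rw [indicator_of_mem (show y ∈ {y : E3 | E4.ofTimeSpace τ y ∈ U} from hy),
      indicator_of_mem (show y ∈ {y : E3 | E4.ofTimeSpace τ y ∈ U} from hy), Real.rpow_zero,
      one_mul, ← ENNReal.ofReal_ofNat 4, ← ENNReal.ofReal_mul (by norm_num)]
    refine ENNReal.ofReal_le_ofReal ?_
    calc coordEnergyDensity U ψ (E4.ofTimeSpace τ y)
        ≤ 4 * ‖fderiv ℝ (Function.extend Subtype.val ψ 0) (E4.ofTimeSpace τ y)‖ ^ 2 :=
          coordEnergyDensity_le_four_mul_norm_fderiv_sq U ψ _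
      _ = 4 * ‖iteratedFDeriv ℝ 1 (Function.extend Subtype.val ψ 0) (E4.ofTimeSpace τ y)‖ ^ 2 := by
          rw [norm_iteratedFDeriv_one]
      _ ≤ 4 * ∑ m ∈ Finset.range (k + 1 + 1),
            ‖iteratedFDeriv ℝ m (Function.extend Subtype.val ψ 0) (E4.ofTimeSpace τ y)‖ ^ 2 := by
          gcongr
          exact Finset.single_le_sum (f := fun m ↦
            ‖iteratedFDeriv ℝ m (Function.extend Subtype.val ψ 0) (E4.ofTimeSpace τ y)‖ ^ 2)
            (fun m _ ↦ sq_nonneg _) (Finset.mem_range.mpr (by omega))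
  · rw [indicator_of_notMem (show y ∉ {y : E3 | E4.ofTimeSpace τ y ∈ U} from hy),
      indicator_of_notMem (show y ∉ {y : E3 | E4.ofTimeSpace τ y ∈ U} from hy), mul_zero]

/-! ### The printed theorems (24) ∧ (25), every order, `a₀`-uniform, for graphs flat on a ball -/

/-- **Dafermos–Rodnianski–Shlapentokh-Rothman, integrated local energy decay WITH THE ZEROTH-ORDER
TERM and at every order, with the printed `a₀`-UNIFORM constant** (Ann. of Math. 183 (2016) =
arXiv:1402.7034, Thm. 3.1, display (24) — whose left side carries `r^{-3-δ}(ψ − ψ_∞)²`,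
`4πψ_∞² = lim_{r'→∞}∫_{Σ₀∩{r=r'}} r⁻²ψ²`, `= 0` for data compactly supported on `Σ̃₀` — together with
Thm. 3.2, display (25) at order `j + 1` — whose non-degenerate second line
`r^{-1-δ}∑_{1≤i₁+i₂+i₃≤j}|∇̸^{i₁}T^{i₂}(Z*)^{i₃}ψ|²` dominates all Kerr–Schild coordinate derivatives
of orders `1, …, j` on `{r ≤ R}`; both in the generalised form of §3.3, p. 14, for admissible
hypersurfaces `Σ̃₀`, `𝓡₀ = D⁺(Σ̃₀)`, `N` kept, and both "for all `|a| ≤ a₀`" with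
`C = C(a₀, M, δ, j)`). **Vendored form** (word for word that of
`DafermosRodnianskiShlapentokhRothman2016_integratedDecay_uniform`, `KerrIntegratedDecayUniform.lean`,
with two changes: the order `j` is a parameter, and the left side is the FULL order-`j` local
coordinate Sobolev energy, zeroth order included): for `0 ≤ a₀ < M` and `j : ℕ` there is
`R₀ = R₀(M, a₀, j) > 0` such that for every admissible height function `F`
(`Kerr.IsAdmissibleHeight M F`) vanishing on `{‖y‖ ≤ ρ}`, `ρ ≥ R₀`, and every `R ≤ ρ` some
`C = C(M, a₀, j, F, ρ, R) < ∞` gives, for all `|a| ≤ a₀` and all smooth solutions `ψ` on the exterior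
chart with data compactly supported on the open graph (`IsAdmissibleKerrWaveOn M a F ψ`),
`∫₀^∞ 𝓔_j(τ, R) dτ ≤ C · (𝓔_{j+1}[ψ](Σ̃₀ ∩ {‖y‖ ≤ ρ}) + ∑_{i ≤ j} E^far_F[T^iψ](0))`, where
`𝓔_j(τ, R) = sliceSobolevEnergy … ψ τ j 0 (closedBall 0 R) = ∫_{‖y‖≤R, r>r₊} ∑_{m≤j}‖D^mψ̃(τ,y)‖² dy`
(the left sides of (24) and (25) dominate `c(M, a₀, R, j)` times its integrand on
`{t*_KS > 0, ‖y‖ ≤ R} ⊆ D⁺(Σ̃₀) ∩ {r ≤ R}`, `dVol = dt*_KS d³y`), on the right the order-`(j+1)`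
coordinate energy of the data on the flat part (dominating `∑_{i≤j}∫(J^N[N^iψ])·n` there: `N`, `n`
smooth up to `𝓗⁺`, `φ_τ`-invariant) and the first-order coordinate energies of `T^iψ = ∂^i_{t*}ψ̃`
(`timeDeriv^[i]`), `i ≤ j`, through the far part of the graph (dominating `∫ J^T[T^iψ]·n` there, where
`N = T`, Prop. 4.5.1 for the whole range `|a| ≤ a₀`). See the module docstring, *The printed
estimates and the vendored consequence*. The 127-page proof is not reproduced: this is a named fact
(D-0014); at `j = 1` it implies the vendored (25) fact
(`DafermosRodnianskiShlapentokhRothman2016_integratedDecay_uniform_of_zeroth`).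
[cite: DafermosRodnianskiShlapentokhrothman2014, Thm. 3.1 (24) and Thm. 3.2 (25) with §3.3 (p. 14) and Prop. 4.5.1] -/
def DafermosRodnianskiShlapentokhRothman2016_integratedDecayZeroth_uniform : Prop :=
  ∀ [Kerr.Facts] [Kerr.SliceFacts] (M a₀ : ℝ), 0 ≤ a₀ → a₀ < M → ∀ j : ℕ,
    ∃ R₀ : ℝ, 0 < R₀ ∧ ∀ (F : E3 → ℝ) (ρ : ℝ), Kerr.IsAdmissibleHeight M F → R₀ ≤ ρ →
      (∀ y : E3, ‖y‖ ≤ ρ → F y = 0) → ∀ R : ℝ, R ≤ ρ →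
      ∃ C : ℝ≥0∞, C < ⊤ ∧ ∀ a : ℝ, |a| ≤ a₀ →
        ∀ ψ : Kerr.exterior M a → ℝ, IsAdmissibleKerrWaveOn M a F ψ →
        ∫⁻ τ in Ioi (0 : ℝ), sliceSobolevEnergy (Kerr.exterior M a) ψ τ j 0 (closedBall (0 : E3) R) ≤
          C * (sliceSobolevEnergy (Kerr.exterior M a) ψ 0 (j + 1) 0 (closedBall (0 : E3) ρ) +
            ∑ i ∈ Finset.range (j + 1),
              graphSliceEnergyOn (Kerr.exterior M a) (timeDeriv^[i] ψ) F 0 {y | ρ < ‖y‖})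

/-! ### The cheap implications -/

/-- **The zeroth-order / every-order fact implies the vendored `a₀`-uniform (25) fact**
(`KerrIntegratedDecayUniform.lean`): take `j = 1`, drop the zeroth-order term on the left
(`localSliceEnergy ≤ 4 · sliceSobolevEnergy … 1 …`, `localSliceEnergy_le_four_mul_sliceSobolevEnergy`)
and unfold `∑_{i<2} E^far_F[T^iψ] = E^far_F[ψ] + E^far_F[Tψ]`; constant `4C`.
[cite: DafermosRodnianskiShlapentokhrothman2014, Thm. 3.1 (24); Thm. 3.2 (25)] -/
theorem DafermosRodnianskiShlapentokhRothman2016_integratedDecay_uniform_of_zeroth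
    (h : DafermosRodnianskiShlapentokhRothman2016_integratedDecayZeroth_uniform) :
    DafermosRodnianskiShlapentokhRothman2016_integratedDecay_uniform := by
  intro instF instS M a₀ ha₀ ha₀M
  obtain ⟨R₀, hR₀, h'⟩ := @h instF instS M a₀ ha₀ ha₀M 1
  refine ⟨R₀, hR₀, fun F ρ hF hρ hF0 R hR ↦ ?_⟩
  obtain ⟨C, hC, hC'⟩ := h' F ρ hF hρ hF0 R hR
  refine ⟨4 * C, ENNReal.mul_lt_top (by simp) hC, fun a ha ψ hψ ↦ ?_⟩
  have hmono := lintegral_mono (μ := volume.restrict (Ioi (0 : ℝ)))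
    fun τ ↦ localSliceEnergy_le_four_mul_sliceSobolevEnergy (Kerr.exterior M a) ψ τ 0 R
  calc ∫⁻ τ in Ioi (0 : ℝ), localSliceEnergy (Kerr.exterior M a) ψ τ R
      ≤ ∫⁻ τ in Ioi (0 : ℝ), 4 * sliceSobolevEnergy (Kerr.exterior M a) ψ τ (0 + 1) 0
          (closedBall (0 : E3) R) := hmono
    _ = 4 * ∫⁻ τ in Ioi (0 : ℝ), sliceSobolevEnergy (Kerr.exterior M a) ψ τ 1 0
          (closedBall (0 : E3) R) := by
        rw [lintegral_const_mul' _ _ (by simp)]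
    _ ≤ 4 * (C * (sliceSobolevEnergy (Kerr.exterior M a) ψ 0 (1 + 1) 0 (closedBall (0 : E3) ρ) +
          ∑ i ∈ Finset.range (1 + 1),
            graphSliceEnergyOn (Kerr.exterior M a) (timeDeriv^[i] ψ) F 0 {y | ρ < ‖y‖})) := by
        gcongr
        exact hC' a ha ψ hψ
    _ = 4 * C * (sliceSobolevEnergy (Kerr.exterior M a) ψ 0 2 0 (closedBall (0 : E3) ρ) +
          graphSliceEnergyOn (Kerr.exterior M a) ψ F 0 {y | ρ < ‖y‖} +
          graphSliceEnergyOn (Kerr.exterior M a) (timeDeriv ψ) F 0 {y | ρ < ‖y‖}) := by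
        rw [Finset.sum_range_succ, Finset.sum_range_one, Function.iterate_zero, Function.iterate_one,
          mul_assoc, add_assoc]
        rfl

/-- **Hence also the non-uniform (25) fact** (`KerrIntegratedDecay.lean`), through
`DafermosRodnianskiShlapentokhRothman2016_integratedDecay_of_uniform`.
[cite: DafermosRodnianskiShlapentokhrothman2014, Thm. 3.2 (25)] -/
theorem DafermosRodnianskiShlapentokhRothman2016_integratedDecay_of_zeroth
    (h : DafermosRodnianskiShlapentokhRothman2016_integratedDecayZeroth_uniform) :
    DafermosRodnianskiShlapentokhRothman2016_integratedDecay :=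
  DafermosRodnianskiShlapentokhRothman2016_integratedDecay_of_uniform
    (DafermosRodnianskiShlapentokhRothman2016_integratedDecay_uniform_of_zeroth h)

end Literature.Geometry.Lorentzian

end
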